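import Literature.NumberTheory.Automorphic.JacquetLemma
import HarnessLib

/-!
# Harish-Chandra's support theorem, generic form: a Jacquet-cuspidal smooth representation has compactly supported
# matrix coefficients, GIVEN a contracting element and a Cartan-type exhaustion (Bernstein–Zelevinsky 1976 §3.18–3.21;
# Casselman 1995 Thm. 5.3.1; Harish-Chandra 1970 Part I §3)

Topic `NumberTheory/Automorphic`; namespace `Representation` (dot-notation extensions, as in the siblings).  THEOREMS ONLY: no
definition, no named fact, no instance, no notation, no `sorry`.  Cell `hodgecm-mathlib`, F0∕P3 «U3-mult», crux H413
(`stmt-HodgeConjecture-24833`), `--supports`: the REPRESENTATION-THEORETIC half of «brick C» (the hypothesis `hC` of ★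
`F0P3LocalIrrepAdmissibleOfCuspidal.localIrrepAdmissible_three_of_cuspidal`, = Harish-Chandra's cuspidal theorem for `U(3)(L⁺_v)` at the
non-split places), done ONCE over an abstract group so that what remains at each place `v` is pure STRUCTURE THEORY of `U(Φ₃)(L⁺_v)`:
a contracting diagonal element, a level filtration of the unipotent radical, and the Cartan decomposition `G = ⋃_{n ≥ 0} K a^n K · Z`
(★ `HermitianLattice.exists_cartan_antidiagonal` at unramified `v`; at ramified `v` not in the tree).  It is Steps 1–3 of ★
`ParabolicInductionCuspidalSupportProofs` (`GL_n` Levi, cut unipotent groups) with the `GL_n` bookkeeping replaced by hypotheses; no Haar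
measure, no Jacquet lemma, no admissibility.  HONEST SCOPE: nothing here supplies those structure facts for any group; the file changes no
`sorry` count; HC_CM is proved only modulo the printed citations until rung 0 closes.

THE MATHEMATICS.  `G` a topological group, `π` a representation of `G` on `V` (over a field `k`), `N ≤ G` a subgroup such that `π` is
«Jacquet-cuspidal along `N`»: every vector lies in `V(N) = span {π(u) y − y : u ∈ N}` (`Coinvariants.ker (π.comp N.subtype) = ⊤`).
Let `(N_j)_{j ∈ ℤ}` be subgroups of `G` inside `N`, increasing, EXHAUSTING `N` and SHRINKING to `1` (every neighbourhood of `1` contains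
some `N_j`), and `a ∈ G` CONTRACTING them: `a N_{j+1} a⁻¹ ≤ N_j`.
* §1 For a smooth linear form `φ` (`φ ∈ π.contragredient`) and any `w`: `φ (π(aⁿ) w) = 0` for all large `n` [BZ76 3.18; Casselman 5.3.1]:
  `w` is a finite combination of `π(u) y − y` with `u ∈ N_J` for one `J` (exhaustion + monotonicity), `Stab(φ) ⊇ N_{j₀}` (smoothness +
  shrinking), and `aⁿ N_J a⁻ⁿ ≤ N_{J−n} ≤ N_{j₀}` for `n ≥ J − j₀`, so `φ (π(aⁿ)(π(u) y − y)) = φ (π(aⁿ u a⁻ⁿ) π(aⁿ) y) − φ (π(aⁿ) y) = 0`.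
* §2 Uniformly: for a subgroup `K₀` with compact closure-set and `π` smooth, `φ (π(k₁ aⁿ k₂) w) = 0` for all `k₁, k₂ ∈ K₀`, `n ≥ n₀`
  — the `K₀`-orbits of `φ` and `w` are finite (★ `finite_orbit_of_isSmoothVector`) [BZ76 3.19].
* §3 Hence, under a CARTAN-TYPE EXHAUSTION `G = ⋃_{n ≥ 0} K₀ aⁿ K₀ · Z(G)`, every smooth matrix coefficient of `π` is supported in the
  compact-mod-centre set `(⋃_{n < n₀} K₀ aⁿ K₀) · Z(G)`: `π.IsSupercuspidal` (★ `Representation.IsSupercuspidal`) [BZ76 3.21; Casselman 5.3.1].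
* §4 The hypothesis in the parabolic-triple currency of ★ `JacquetModule`: `Subsingleton (t.restrict π).Coinvariants` gives
  `Coinvariants.ker (π.comp t.N.subtype) = ⊤`.

## References
* [BernsteinZelevinsky1976] I. N. Bernstein, A. V. Zelevinsky, *Representations of the group `GL(n, F)` where `F` is a non-archimedean
  local field*, Russian Math. Surveys 31:3 (1976) 1–68: §3.18–3.21.
* [Casselman1995] W. Casselman, *Introduction to the theory of admissible representations of `p`-adic reductive groups*, notes (draft
  1 May 1995): Thm. 5.3.1, §5.4, Thm. 6.3.5.
* [HarishChandra1970] Harish-Chandra (notes by G. van Dijk), *Harmonic analysis on reductive `p`-adic groups*, LNM 162 (1970): Part I §3.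
* [BushnellHenniart2006] C. J. Bushnell, G. Henniart, *The local Langlands conjecture for `GL(2)`* (2006): §10.1.
-/

open scoped Pointwise

noncomputable section

namespace Representation

open Literature.NumberTheory.Automorphic Literature.NumberTheory.Automorphic.JacquetLemma

section Algebraic

variable {k G V : Type*} [Field k] [Group G] [AddCommGroup V] [Module k V] (π : Representation k G V)

/-! ## §0 Two bookkeeping lemmas on the dual action and on conjugates -/

/-- `φ (π(g) y) = (π^*(g⁻¹) φ) y`. [folklore] -/
private theorem apply_apply_eq_dual_apply_of_inv (φ : Module.Dual k V) (g : G) (y : V) :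
    φ (π g y) = π.dual g⁻¹ φ y := by
  rw [dual_apply, inv_inv, Module.Dual.transpose_apply, LinearMap.comp_apply]

/-- A linear form is invariant under the elements of its stabiliser for the dual action: `φ (π(g) y) = φ y` for `g ∈ Stab(φ)`
(a subgroup, so `g⁻¹ ∈ Stab(φ)` too). [folklore] -/
private theorem apply_apply_eq_of_mem_stabilizer_dual {φ : Module.Dual k V} {g : G} (hg : g ∈ π.dual.stabilizerSubgroup φ) (y : V) :
    φ (π g y) = φ y := by
  rw [apply_apply_eq_dual_apply_of_inv, (π.dual.mem_stabilizerSubgroup φ _).1 (inv_mem hg)]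

/-- Iterated contraction: if `a N_{j+1} a⁻¹ ≤ N_j` for all `j` then `aⁿ N_{j+n} a⁻ⁿ ≤ N_j`. [cite: BernsteinZelevinsky1976, §3.18–3.21] -/
private theorem conj_pow_mem_of_contracting (Nf : ℤ → Subgroup G) (a : G)
    (hcontr : ∀ j : ℤ, ∀ u ∈ Nf (j + 1), a * u * a⁻¹ ∈ Nf j) :
    ∀ (n : ℕ) (j : ℤ), ∀ u ∈ Nf (j + n), a ^ n * u * (a ^ n)⁻¹ ∈ Nf j := by
  intro n
  induction n with
  | zero => intro j u hu; simpa using hu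
  | succ n ih =>
    intro j u hu
    have hu' : u ∈ Nf ((j + 1) + n) := by rwa [add_assoc, add_comm (1 : ℤ) n, ← Nat.cast_succ]
    have h1 := ih (j + 1) u hu'
    have h2 := hcontr j _ h1
    simpa only [pow_succ', mul_inv_rev, mul_assoc] using h2

/-- A step-increasing family of subgroups is increasing. [folklore] -/
private theorem le_of_step_mono (Nf : ℤ → Subgroup G) (hmono : ∀ j : ℤ, Nf j ≤ Nf (j + 1)) :
    ∀ i j : ℤ, i ≤ j → Nf i ≤ Nf j := by
  intro i j hij
  obtain ⟨d, rfl⟩ := Int.le.dest hij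
  induction d with
  | zero => simp
  | succ d ih => exact (ih (by omega)).trans (by simpa [add_assoc] using hmono (i + d))

/-! ## §1 One coefficient: `φ (π(aⁿ) w) = 0` for large `n` -/

/-- The level spans `span {π(u) y − y : u ∈ N_j}` increase with `j` when the `N_j` do. [cite: BernsteinZelevinsky1976, §3.18–3.21] -/
theorem span_level_mono (Nf : ℤ → Subgroup G) (hmono : ∀ j : ℤ, Nf j ≤ Nf (j + 1)) {i j : ℤ} (hij : i ≤ j) :
    Submodule.span k {y | ∃ u ∈ Nf i, ∃ v : V, y = π u v - v} ≤ Submodule.span k {y | ∃ u ∈ Nf j, ∃ v : V, y = π u v - v} :=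
  Submodule.span_mono fun _ ⟨u, hu, v, hy⟩ => ⟨u, le_of_step_mono Nf hmono i j hij hu, v, hy⟩

/-- Every vector of `V(N) = span {π(u) y − y : u ∈ N}` lies in `span {π(u) y − y : u ∈ N_J}` for ONE level `J`, when the `N_j`
are increasing and exhaust `N`. [cite: BernsteinZelevinsky1976, §3.18–3.21] -/
theorem exists_mem_span_level_of_mem_coinvariantsKer (N : Subgroup G) (Nf : ℤ → Subgroup G)
    (hmono : ∀ j : ℤ, Nf j ≤ Nf (j + 1)) (hexh : ∀ u ∈ N, ∃ j : ℤ, u ∈ Nf j)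
    {w : V} (hw : w ∈ Coinvariants.ker (π.comp N.subtype)) :
    ∃ J : ℤ, w ∈ Submodule.span k {y | ∃ u ∈ Nf J, ∃ v : V, y = π u v - v} := by
  induction hw using Submodule.span_induction with
  | mem y hy =>
    obtain ⟨⟨u, x⟩, rfl⟩ := hy
    obtain ⟨j, hj⟩ := hexh u u.2
    exact ⟨j, Submodule.subset_span ⟨u, hj, x, rfl⟩⟩
  | zero => exact ⟨0, Submodule.zero_mem _⟩
  | add x y _ _ hx hy =>
    obtain ⟨i, hi⟩ := hx
    obtain ⟨j, hj⟩ := hy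
    exact ⟨max i j, Submodule.add_mem _ (π.span_level_mono Nf hmono (le_max_left i j) hi)
      (π.span_level_mono Nf hmono (le_max_right i j) hj)⟩
  | smul c x _ hx =>
    obtain ⟨i, hi⟩ := hx
    exact ⟨i, Submodule.smul_mem _ c hi⟩

/-- The level spans are stable under `π(z)` for `z` commuting with `N_J` (e.g. `z` central): `π(z)(π(u) y − y) = π(u)(π(z) y) − π(z) y`.
[cite: BernsteinZelevinsky1976, §3.18–3.21] -/
theorem apply_mem_span_level_of_comm (Nf : ℤ → Subgroup G) (J : ℤ) {z : G} (hz : ∀ u ∈ Nf J, z * u = u * z) {w : V}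
    (hw : w ∈ Submodule.span k {y | ∃ u ∈ Nf J, ∃ v : V, y = π u v - v}) :
    π z w ∈ Submodule.span k {y | ∃ u ∈ Nf J, ∃ v : V, y = π u v - v} := by
  induction hw using Submodule.span_induction with
  | mem y hy =>
    obtain ⟨u, hu, v, rfl⟩ := hy
    refine Submodule.subset_span ⟨u, hu, π z v, ?_⟩
    rw [map_sub, ← Module.End.mul_apply, ← map_mul, hz u hu, map_mul, Module.End.mul_apply]
  | zero => rw [map_zero]; exact Submodule.zero_mem _
  | add x y _ _ hx hy => rw [map_add]; exact Submodule.add_mem _ hx hy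
  | smul c x _ hx => rw [map_smul]; exact Submodule.smul_mem _ c hx

/-- **One coefficient vanishes far out along the contracting element** [BZ76 3.18; Casselman 1995 Thm. 5.3.1], explicit form: if
`w` has level `J`, the stabiliser of the linear form `φ` (dual action) contains `N_{j₀}`, and `a N_{j+1} a⁻¹ ≤ N_j` for all `j`, then
`φ (π(aⁿ) w) = 0` whenever `J ≤ j₀ + n` — since `aⁿ N_J a⁻ⁿ ≤ N_{J−n} ≤ N_{j₀} ⊆ Stab(φ)` and
`φ (π(aⁿ)(π(u) y − y)) = φ (π(aⁿ u a⁻ⁿ) π(aⁿ) y) − φ (π(aⁿ) y) = 0`. [cite: BernsteinZelevinsky1976, §3.18–3.21] [cite: Casselman1995, Thm. 5.3.1] -/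
theorem apply_pow_apply_eq_zero_of_mem_span_level (Nf : ℤ → Subgroup G) (hmono : ∀ j : ℤ, Nf j ≤ Nf (j + 1))
    (a : G) (hcontr : ∀ j : ℤ, ∀ u ∈ Nf (j + 1), a * u * a⁻¹ ∈ Nf j)
    {φ : Module.Dual k V} {j₀ : ℤ} (hj₀ : (Nf j₀ : Set G) ⊆ π.dual.stabilizerSubgroup φ)
    {w : V} {J : ℤ} (hJ : w ∈ Submodule.span k {y | ∃ u ∈ Nf J, ∃ v : V, y = π u v - v})
    (n : ℕ) (hn : J ≤ j₀ + n) : φ (π (a ^ n) w) = 0 := by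
  have hstab : ∀ u ∈ Nf J, a ^ n * u * (a ^ n)⁻¹ ∈ π.dual.stabilizerSubgroup φ := by
    intro u hu
    have hu' : u ∈ Nf ((J - n) + n) := by rwa [sub_add_cancel]
    exact hj₀ (le_of_step_mono Nf hmono (J - n) j₀ (by omega) (conj_pow_mem_of_contracting Nf a hcontr n (J - n) u hu'))
  have hgen : ∀ y ∈ {y | ∃ u ∈ Nf J, ∃ v : V, y = π u v - v}, φ (π (a ^ n) y) = 0 := by
    rintro _ ⟨u, hu, v, rfl⟩
    have hconj : a ^ n * u = (a ^ n * u * (a ^ n)⁻¹) * a ^ n := by rw [inv_mul_cancel_right]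
    rw [map_sub, map_sub, ← Module.End.mul_apply, ← map_mul, hconj, map_mul, Module.End.mul_apply,
      π.apply_apply_eq_of_mem_stabilizer_dual (hstab u hu), sub_self]
  induction hJ using Submodule.span_induction with
  | mem y hy => exact hgen y hy
  | zero => rw [map_zero, map_zero]
  | add x y _ _ hx hy => rw [map_add, map_add, hx, hy, add_zero]
  | smul c x _ hx => rw [map_smul, map_smul, hx, smul_zero]

/-- If the Jacquet module of `π` along a parabolic triple `t` vanishes (`Subsingleton (t.restrict π).Coinvariants`, the currency of ★
`JacquetModule`), then every vector lies in `V(N)` for `N = t.N ≤ G`: `Coinvariants.ker (π.comp t.N.subtype) = ⊤` (the two kernels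
have the same generators `π(u) y − y`, `u ∈ N`). [cite: BernsteinZelevinsky1976, §3.18–3.21] -/
theorem coinvariantsKer_eq_top_of_subsingleton (t : ParabolicTriple G) [Subsingleton (t.restrict π).Coinvariants] :
    Coinvariants.ker (π.comp t.N.subtype) = ⊤ := by
  refine eq_top_iff.2 fun w _ => ?_
  have hw : Coinvariants.mk (t.restrict π) w = 0 := Subsingleton.elim _ _
  rw [Coinvariants.mk_eq_zero] at hw
  -- the generators of the two kernels correspond along `u ↦ ⟨⟨u, _⟩, _⟩`
  have hle : Coinvariants.ker (t.restrict π) ≤ Coinvariants.ker (π.comp t.N.subtype) := by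
    refine Submodule.span_le.2 ?_
    rintro _ ⟨⟨x, v⟩, rfl⟩
    exact Coinvariants.mem_ker_of_eq (ρ := π.comp t.N.subtype) ⟨(x : t.P), Subgroup.mem_subgroupOf.1 x.2⟩ v _ rfl
  exact hle hw

end Algebraic

section Topological

variable {k G V : Type*} [Field k] [Group G] [TopologicalSpace G] [IsTopologicalGroup G]
  [AddCommGroup V] [Module k V] (π : Representation k G V)

/-! ## §2 Uniformity over a compact subgroup `K₀` and the centre -/

/-- **Uniform bound** [BZ76 3.19]: `π` smooth and Jacquet-cuspidal along `N` (every vector in `V(N)`), `(N_j)` increasing, exhausting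
`N`, shrinking to `1` and contracted by `a`; `K₀` a subgroup inside a compact set.  Then for a smooth linear form `φ` and any `w` there is
`n₀` with `φ (π(k₁ aⁿ k₂ z) w) = 0` for all `k₁, k₂ ∈ K₀`, all CENTRAL `z` and all `n ≥ n₀`:
`φ (π(k₁ aⁿ k₂ z) w) = (π^*(k₁⁻¹) φ)(π(aⁿ)(π(z)(π(k₂) w)))`, the `K₀`-orbits of `φ` and `w` are finite (★ `finite_orbit_of_isSmoothVector`),
and `π(z)` preserves levels (`apply_mem_span_level_of_comm`). [cite: BernsteinZelevinsky1976, §3.18–3.21] -/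
theorem exists_forall_apply_conj_pow_apply_eq_zero (hπ : π.IsSmooth) (N : Subgroup G)
    (hker : Coinvariants.ker (π.comp N.subtype) = ⊤)
    (Nf : ℤ → Subgroup G) (hmono : ∀ j : ℤ, Nf j ≤ Nf (j + 1)) (hexh : ∀ u ∈ N, ∃ j : ℤ, u ∈ Nf j)
    (hsmall : ∀ U ∈ nhds (1 : G), ∃ j : ℤ, (Nf j : Set G) ⊆ U)
    (a : G) (hcontr : ∀ j : ℤ, ∀ u ∈ Nf (j + 1), a * u * a⁻¹ ∈ Nf j)
    (K₀ : Subgroup G) {C : Set G} (hC : IsCompact C) (hK₀C : (K₀ : Set G) ⊆ C)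
    {φ : Module.Dual k V} (hφ : φ ∈ π.contragredient) (w : V) :
    ∃ n₀ : ℕ, ∀ n : ℕ, n₀ ≤ n → ∀ k₁ ∈ K₀, ∀ k₂ ∈ K₀, ∀ z ∈ Subgroup.center G, φ (π (k₁ * a ^ n * k₂ * z) w) = 0 := by
  set Oφ : Set (Module.Dual k V) := (fun g : G => π.dual g φ) '' (K₀ : Set G) with hOφ
  set Ow : Set V := (fun g : G => π g w) '' (K₀ : Set G) with hOw
  have hOφf : Oφ.Finite := finite_orbit_of_isSmoothVector π.dual K₀ hC hK₀C hφ
  have hOwf : Ow.Finite := finite_orbit_of_isSmoothVector π K₀ hC hK₀C (hπ w)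
  -- §1 for every pair in the product of the orbits (vacuous bound outside)
  have hpair : ∀ x : Module.Dual k V × V, ∃ n₀ : ℕ, x ∈ Oφ ×ˢ Ow →
      ∀ n : ℕ, n₀ ≤ n → ∀ z ∈ Subgroup.center G, x.1 (π (a ^ n) (π z x.2)) = 0 := by
    rintro ⟨φ', w'⟩
    by_cases hx : (φ', w') ∈ Oφ ×ˢ Ow
    · obtain ⟨⟨g, -, rfl⟩, -⟩ := hx
      have hφ' : π.dual g φ ∈ π.contragredient := π.contragredient.apply_mem_toSubmodule g hφ
      obtain ⟨j₀, hj₀⟩ := hsmall _ (((π.mem_contragredient _).1 hφ').mem_nhds (Subgroup.one_mem _))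
      have hw' : w' ∈ Coinvariants.ker (π.comp N.subtype) := by rw [hker]; trivial
      obtain ⟨J, hJ⟩ := π.exists_mem_span_level_of_mem_coinvariantsKer N Nf hmono hexh hw'
      refine ⟨(J - j₀).toNat, fun _ n hn z hz => ?_⟩
      refine π.apply_pow_apply_eq_zero_of_mem_span_level Nf hmono a hcontr hj₀
        (π.apply_mem_span_level_of_comm Nf J (fun u hu => ?_) hJ) n (by omega)
      exact ((Subgroup.mem_center_iff.1 hz) u).symm
    · exact ⟨0, fun h => absurd h hx⟩
  choose n₀ hn₀ using hpair
  refine ⟨(hOφf.prod hOwf).toFinset.sum n₀, fun n hn k₁ hk₁ k₂ hk₂ z hz => ?_⟩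
  have hmem : (π.dual k₁⁻¹ φ, π k₂ w) ∈ Oφ ×ˢ Ow := ⟨⟨k₁⁻¹, inv_mem hk₁, rfl⟩, ⟨k₂, hk₂, rfl⟩⟩
  have hle : n₀ (π.dual k₁⁻¹ φ, π k₂ w) ≤ (hOφf.prod hOwf).toFinset.sum n₀ :=
    Finset.single_le_sum (f := n₀) (fun _ _ => Nat.zero_le _) ((Set.Finite.mem_toFinset _).2 hmem)
  have hkz : k₂ * z = z * k₂ := (Subgroup.mem_center_iff.1 hz) k₂
  rw [mul_assoc (k₁ * a ^ n) k₂ z, hkz, map_mul, map_mul, map_mul, Module.End.mul_apply, Module.End.mul_apply,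
    Module.End.mul_apply, apply_apply_eq_dual_apply_of_inv]
  exact hn₀ _ hmem n (hle.trans hn) z hz

/-! ## §3 Compact support modulo the centre, given a Cartan-type exhaustion -/

/-- **Harish-Chandra's support theorem, generic form** [BZ76 3.21; Casselman 1995 Thm. 5.3.1; HC 1970 I §3]: let `π` be SMOOTH and
Jacquet-cuspidal along `N` (every vector in `V(N)`), `(N_j)` a contracting level filtration for `a` as above, and `K₀` a compact subgroup
such that `G = K₀ · {aⁿ : n ≥ 0} · K₀ · Z(G)` (Cartan-type exhaustion).  Then every smooth matrix coefficient of `π` has support in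
`(K₀ · {aⁿ : n < n₀} · K₀) · Z(G)`, a compact set times the centre: `π.IsSupercuspidal`. [cite: BernsteinZelevinsky1976, §3.18–3.21]
[cite: Casselman1995, Thm. 5.3.1] -/
theorem isSupercuspidal_of_coinvariantsKer_eq_top_of_cartan (hπ : π.IsSmooth) (N : Subgroup G)
    (hker : Coinvariants.ker (π.comp N.subtype) = ⊤)
    (Nf : ℤ → Subgroup G) (hmono : ∀ j : ℤ, Nf j ≤ Nf (j + 1)) (hexh : ∀ u ∈ N, ∃ j : ℤ, u ∈ Nf j)
    (hsmall : ∀ U ∈ nhds (1 : G), ∃ j : ℤ, (Nf j : Set G) ⊆ U)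
    (a : G) (hcontr : ∀ j : ℤ, ∀ u ∈ Nf (j + 1), a * u * a⁻¹ ∈ Nf j)
    (K₀ : Subgroup G) (hK₀ : IsCompact (K₀ : Set G))
    (hcartan : ∀ g : G, ∃ k₁ ∈ K₀, ∃ k₂ ∈ K₀, ∃ n : ℕ, ∃ z ∈ Subgroup.center G, g = k₁ * a ^ n * k₂ * z) :
    π.IsSupercuspidal := by
  intro φ hφ w
  obtain ⟨n₀, hn₀⟩ :=
    π.exists_forall_apply_conj_pow_apply_eq_zero hπ N hker Nf hmono hexh hsmall a hcontr K₀ hK₀ subset_rfl hφ w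
  set D : Set G := (fun n : ℕ => a ^ n) '' Set.Iio n₀ with hD
  refine ⟨(K₀ : Set G) * D * (K₀ : Set G), (hK₀.mul ((Set.finite_Iio n₀).image _).isCompact).mul hK₀, fun g hg => ?_⟩
  rw [Function.mem_support, matrixCoeff_apply] at hg
  obtain ⟨k₁, hk₁, k₂, hk₂, n, z, hz, rfl⟩ := hcartan g
  have hn : n < n₀ := by
    by_contra h
    exact hg (hn₀ n (not_lt.1 h) k₁ hk₁ k₂ hk₂ z hz)
  exact Set.mem_mul.2 ⟨k₁ * a ^ n * k₂, Set.mul_mem_mul (Set.mul_mem_mul hk₁ ⟨n, hn, rfl⟩) hk₂, z, hz, rfl⟩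

/-! ## §4 Packaging in the parabolic-triple currency of `JacquetModule` -/

/-- **Harish-Chandra's support theorem along a parabolic triple** (packaging of §3 with §4): a smooth `π` with vanishing Jacquet module
along `t`, a contracting level filtration of `t.N` for `a`, and a Cartan-type exhaustion `G = K₀ · {aⁿ} · K₀ · Z(G)` give
`π.IsSupercuspidal`. [cite: BernsteinZelevinsky1976, §3.18–3.21] [cite: Casselman1995, Thm. 5.3.1] -/
theorem isSupercuspidal_of_subsingleton_coinvariants_of_cartan (hπ : π.IsSmooth) (t : ParabolicTriple G)
    [Subsingleton (t.restrict π).Coinvariants]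
    (Nf : ℤ → Subgroup G) (hmono : ∀ j : ℤ, Nf j ≤ Nf (j + 1)) (hexh : ∀ u ∈ t.N, ∃ j : ℤ, u ∈ Nf j)
    (hsmall : ∀ U ∈ nhds (1 : G), ∃ j : ℤ, (Nf j : Set G) ⊆ U)
    (a : G) (hcontr : ∀ j : ℤ, ∀ u ∈ Nf (j + 1), a * u * a⁻¹ ∈ Nf j)
    (K₀ : Subgroup G) (hK₀ : IsCompact (K₀ : Set G))
    (hcartan : ∀ g : G, ∃ k₁ ∈ K₀, ∃ k₂ ∈ K₀, ∃ n : ℕ, ∃ z ∈ Subgroup.center G, g = k₁ * a ^ n * k₂ * z) :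
    π.IsSupercuspidal :=
  π.isSupercuspidal_of_coinvariantsKer_eq_top_of_cartan hπ t.N (π.coinvariantsKer_eq_top_of_subsingleton t) Nf hmono hexh
    hsmall a hcontr K₀ hK₀ hcartan

end Topological

end Representation

end
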